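import Mathlib
import HarnessLib
import Summits.NavierStokesRegularity.NavierStokesRegularity.Theorems.TaylorModelRungThreeCertificateReadoutVInterpWin
import Summits.NavierStokesRegularity.NavierStokesRegularity.Theorems.TaylorModelRungThreeCertificateReadoutVStepWinSound
import Summits.NavierStokesRegularity.NavierStokesRegularity.Theorems.TaylorModelRungThreeCertificateReadoutVSoundB

/-!
# Crux K1b-DR (stmt-NavierStokesRegularity-23954), line `taylor-model` — v3 WINDOWED read-outs SOUNDNESS, part A (ns-tm-g4 g6):
# bridges from the interpreted records `toCertDataVW / toBoxesW / toRadiiW / toReadoutDataWin / toWinData` to the windowed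
# read-out kernel `readoutStepWin` (`…ReadoutVStepWin/…StepWinSound`), and the clauses (R5), (R7), (R8w), (R9w), (W1), (W2), (W3)
# of `ReadoutsVW` (`…VReadoutsWinDefs`) for those records

Window analogue of typer g32's `…ReadoutVSoundA` (whose generic bridges — `memVec_of_inBox_hull`, `inStep_window`, `mem_covB`,
`rlo_le`, `tail_le`, `mem_AK`, `mem_faceB`, `mem_listB`, `lengths_le_nF`, … — are reused as landed: the windowed input's `base` IS
part 5's `roIn`).  From `(TV.roOutWin kitOf wT A WV j).ok = true`:
* `wv_inStep_state` — window values of an in-step state `TP(u) + r + kapp A (y − x)`;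
* `readoutW_Zl_gen` — the in-step state of a hull-`l` start at `u` (inside the level-1 window, `u ∈ U`, `u ≤ uR`) lies in the
  kernel's box `Zl U uR Hl`;
* `readoutW_R5`, `readoutW_R7` (fat box), `readoutW_R8` (on `Z¹`), `readoutW_R9` (on `Z⁰`), `readoutW_W1` (window order),
  `readoutW_W2` / `readoutW_W3` (window-end sections, both levels).
Part B: (R6), (R10w), (R11w), (W4) and the assembly `readoutsVW_of_checks'`.

HONEST FRAMING: kernel bookkeeping for the MODEL certificate №23954 (rung TL-M3); nothing here is a statement about the
Navier–Stokes equations.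
-/

-- the sub-problem namespace repeats the summit name by design (D-0017)
set_option linter.dupNamespace false

namespace Summit.NavierStokesRegularity.NavierStokesRegularity.Theorems.TaylorModelCert

open scoped BigOperators
open Set
open Literature.Analysis.FluidPDE.TaoCascade Literature.Analysis.FluidPDE.TaoCascade.TaylorChain
open Summit.NavierStokesRegularity.NavierStokesRegularity.Theorems.TaylorModelReadout
open Summit.NavierStokesRegularity.NavierStokesRegularity.Theorems.TaylorModelV

namespace CertTablesV

variable {TV : CertTablesV} {kitOf : ℕ → CoreKit} {wT : ℕ → Array Dyad} {sc : ScalarsV} {A : ReadoutAux QS2} {WV : WindowsV}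

/-! ### Window values of an in-step state -/

/-- Window values of the in-step state `TP(u) + r + kapp Ak (y − x j s)` of the interpreted record. [folklore] -/
theorem wv_inStep_state (j s : ℕ) (u : ℝ) (Ak : Ker) (y r : Fin 4 → ℤ → ℝ) {c : ℕ} (hc : c < TV.base.n) :
    TV.base.wv ((TV.toCertDataVW kitOf wT sc).TP j s u + r +
      kapp (TV.toCertDataVW kitOf wT sc) Ak (y - (TV.toCertDataVW kitOf wT sc).x j s)) c =
      (∑ n ∈ Finset.range (TV.base.pdeg + 1), taylorJet (TV.base.toCertData QS2.toRealHom).Qb (TV.base.vecF (vre (TV.xD j s))) n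
          (TV.base.wi c) (TV.base.wk c) * u ^ n) + TV.base.wv r c +
        ∑ c' ∈ Finset.range TV.base.n, Ak (TV.base.wi c) (TV.base.wk c) (TV.base.wi c') (TV.base.wk c') *
          (TV.base.wv y c' - vre (TV.xD j s) c') := by
  rw [TV.base.wv_add, TV.base.wv_add, wv_kapp Ak _ hc]
  have e1 : TV.base.wv ((TV.toCertDataVW kitOf wT sc).TP j s u) c =
      ∑ n ∈ Finset.range (TV.base.pdeg + 1), taylorJet (TV.base.toCertData QS2.toRealHom).Qb (TV.base.vecF (vre (TV.xD j s))) n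
        (TV.base.wi c) (TV.base.wk c) * u ^ n := rfl
  have e2 : ∀ c' ∈ Finset.range TV.base.n, TV.base.wv (y - (TV.toCertDataVW kitOf wT sc).x j s) c' = TV.base.wv y c' - vre (TV.xD j s) c' := by
    intro c' hc'
    rw [← TV.base.wv_vecF (vre (TV.xD j s)) (Finset.mem_range.1 hc')]
    rfl
  rw [e1]
  congr 1
  exact Finset.sum_congr rfl fun c' hc' => by rw [e2 c' hc']

/-! ### The windowed in-step box of the records -/

/-- **The windowed in-step box, generic**: for `u ∈ U` inside the level-1 window (`u1lo ≤ u ≤ u1hi`), `u ≤ uR`, an in-step kernel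
`Ak` at `u`, a hull-`l` start `y` and a remainder `r`, the window values of `TP(u) + r + kapp Ak (y − x)` lie in `Zl U uR Hl`
(`Hl` = the hull box of level `l`). [folklore] -/
theorem readoutW_Zl_gen (hk : KitOK TV kitOf) {j : ℕ} (hok : (TV.roOutWin kitOf wT A WV j).ok = true) {l : Fin 3} {Hl : Array IntervalD}
    (hH : Hl = TV.hullBox kitOf wT j l ((TV.base.stage j).S - 1)) {U : IntervalD} {uR : Dyad}
    {u : ℝ} (huU : IntervalD.mem u U) (hulo : (winAt WV j).u1lo.toReal ≤ u) (huhi : u ≤ (winAt WV j).u1hi.toReal) (huR : u ≤ uR.toReal)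
    {Ak : Ker} (hA : InStepKer (TV.toCertDataVW kitOf wT sc) (TV.toBoxesW kitOf wT) j ((TV.toCertDataVW kitOf wT sc).S j - 1) u Ak)
    {y : Fin 4 → ℤ → ℝ} (hy : InBox (TV.toCertDataVW kitOf wT sc) ((TV.toBoxesW kitOf wT).hlo l j ((TV.toCertDataVW kitOf wT sc).S j - 1))
      ((TV.toBoxesW kitOf wT).hhi l j ((TV.toCertDataVW kitOf wT sc).S j - 1)) y)
    {r : Fin 4 → ℤ → ℝ} (hr : AbsLeW (TV.toCertDataVW kitOf wT sc) r
      (fun i k => (TV.toBoxesW kitOf wT).J j ((TV.toCertDataVW kitOf wT sc).S j - 1) i k * u ^ ((TV.toCertDataVW kitOf wT sc).pdeg + 1))) :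
    MemVec TV.base.n (TV.base.wv ((TV.toCertDataVW kitOf wT sc).TP j ((TV.toCertDataVW kitOf wT sc).S j - 1) u + r +
        kapp (TV.toCertDataVW kitOf wT sc) Ak (y - (TV.toCertDataVW kitOf wT sc).x j ((TV.toCertDataVW kitOf wT sc).S j - 1))))
      ((TV.roInWin kitOf wT A WV j).Zl TV.base U uR Hl) := by
  set s := (TV.base.stage j).S - 1 with hs
  have hSs : (TV.toCertDataVW kitOf wT sc).S j - 1 = s := rfl
  rw [hSs] at hA hy hr ⊢
  have hu0 : 0 ≤ u := (TV.base.readoutStepWin_win (TV.roInWin kitOf wT A WV j) hok).1.trans hulo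
  have hF := TV.base.readoutStepWin_Zl (TV.roInWin kitOf wT A WV j) hk.coef (hk.box j) (hk.mt j) (size_hullBox 2 j s) huU hu0 hulo huhi huR
    (fun i k h1 h2 => mem_ωinvB j i k h1 h2) (inStep_window hA) (Hl := Hl) (by rw [hH]; exact memVec_of_inBox_hull hy)
    (r := r) (fun c hc => by
      have hkc := TV.base.InW_wk hc
      have h1 := hr (TV.base.wi c) (TV.base.wk c) hkc.1 hkc.2
      dsimp only at h1
      rw [bx_J, TV.base.vecF_apply, if_pos hkc, TV.base.idx_wi_wk hc] at h1
      exact h1)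
  intro c hc
  rw [wv_inStep_state j s u Ak y r hc]
  exact hF c hc

/-! ### (R5), (R7) -/

/-- **(R5)** of `ReadoutsVW` at stage `j` (section at the nodes). [folklore] -/
theorem readoutW_R5 {j : ℕ} (hok : (TV.roOutWin kitOf wT A WV j).ok = true) :
    (∀ y, InBox (TV.toCertDataVW kitOf wT sc) ((TV.toBoxesW kitOf wT).hlo 1 j ((TV.toCertDataVW kitOf wT sc).S j - 1))
        ((TV.toBoxesW kitOf wT).hhi 1 j ((TV.toCertDataVW kitOf wT sc).S j - 1)) y →
      (TV.toCertDataVW kitOf wT sc).σf j y < (TV.toCertDataVW kitOf wT sc).lev j) ∧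
    (∀ y, InBox (TV.toCertDataVW kitOf wT sc) ((TV.toBoxesW kitOf wT).hlo 1 j ((TV.toCertDataVW kitOf wT sc).S j))
        ((TV.toBoxesW kitOf wT).hhi 1 j ((TV.toCertDataVW kitOf wT sc).S j)) y →
      (TV.toCertDataVW kitOf wT sc).lev j < (TV.toCertDataVW kitOf wT sc).σf j y) := by
  have h := TV.base.readoutStepWin_R5 (TV.roInWin kitOf wT A WV j) hok (mem_covB (TV.base.stage j).σf)
    (IntervalD.mem_ofQS2 TV.prec (TV.base.stage j).lev)
  refine ⟨fun y hy => ?_, fun y hy => ?_⟩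
  · rw [cd_sigma, cd_lev]; exact h.1 y (memVec_of_inBox_hull hy)
  · rw [cd_sigma, cd_lev]; exact h.2 y (memVec_of_inBox_hull hy)

/-- **(R7)** of `ReadoutsVW` at stage `j` (on the fat level-1 box). [folklore] -/
theorem readoutW_R7 (hk : KitOK TV kitOf) {G : ℕ → ℕ → ℕ → ℝ} {ΛT : ℕ → ℝ} {j : ℕ} (hok : (TV.roOutWin kitOf wT A WV j).ok = true) :
    ∀ y, InBox (TV.toCertDataVW kitOf wT sc) ((TV.toReadoutDataWin kitOf wT A WV G ΛT).ylo 1 j) ((TV.toReadoutDataWin kitOf wT A WV G ΛT).yhi 1 j) y →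
      (TV.toCertDataVW kitOf wT sc).γ j ≤ (TV.toCertDataVW kitOf wT sc).σf j ((TV.toCertDataVW kitOf wT sc).Qb y y) := by
  intro y hy
  rw [row_ylo1, row_yhi1] at hy
  rw [cd_gamma, cd_sigma, cd_Qb]
  exact TV.base.readoutStepWin_R7 (TV.roInWin kitOf wT A WV j) hk.coef (hk.box j) (hk.mt j) hok (mem_covB (TV.base.stage j).σf)
    (IntervalD.mem_ofQS2 TV.prec (TV.base.stage j).γ) y (memVec_of_inBox_loR hy)

/-! ### (R8w), (R9w) on the windowed boxes -/

/-- **(R8w)** of `ReadoutsVW` at stage `j` (crossing read-outs on `Z¹`). [folklore] -/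
theorem readoutW_R8 (hA : TV.base.checkReadoutAux A = true) {j : ℕ} (hok : (TV.roOutWin kitOf wT A WV j).ok = true) :
    ∀ y, InBox (TV.toCertDataVW kitOf wT sc) ((TV.toWinData kitOf wT A WV).zlo 1 j) ((TV.toWinData kitOf wT A WV).zhi 1 j) y →
      (TV.toCertDataVW kitOf wT sc).σf j y = (TV.toCertDataVW kitOf wT sc).lev j →
      (TV.toCertDataVW kitOf wT sc).as j ≤ |y (TV.toCertDataVW kitOf wT sc).i₀ 1| ∧
      ∀ i, |y i (-(TV.toCertDataVW kitOf wT sc).Kb)| + (TV.toCertDataVW kitOf wT sc).Λ j * (TV.toCertDataVW kitOf wT sc).δ j *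
          (TV.toCertDataVW kitOf wT sc).τs * (TV.toCertDataVW kitOf wT sc).ω j (-(TV.toCertDataVW kitOf wT sc).Kb) ≤
        (2:ℝ) ^ (-(TV.toCertDataVW kitOf wT sc).θ) *
          ((TV.toCertDataVW kitOf wT sc).Cb * (2:ℝ) ^ ((3:ℝ) / 4 * (((TV.toCertDataVW kitOf wT sc).Kb : ℝ) + 1))) := by
  intro y hy _
  rw [rw_zlo1, rw_zhi1] at hy
  have h := TV.base.readoutStepWin_R8 (TV.roInWin kitOf wT A WV j) hok (IntervalD.mem_ofQS2 TV.prec (TV.base.stage j).as)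
    (mem_AK (kitOf := kitOf) (wT := wT) (sc := sc) hA j) (rlo_le (kitOf := kitOf) (wT := wT) (sc := sc) hA) y (memVec_of_inBox_loR hy)
  rw [cd_as, cd_i0]
  refine ⟨h.1, fun i => ?_⟩
  have h2 := h.2 i
  rw [cd_Kb] at h2 ⊢
  exact h2

/-- **(R9w)** of `ReadoutsVW` at stage `j` (base landing on `Z⁰`). [folklore] -/
theorem readoutW_R9 (hA : TV.base.checkReadoutAux A = true) {j : ℕ} (hok : (TV.roOutWin kitOf wT A WV j).ok = true) :
    ∀ y, InBox (TV.toCertDataVW kitOf wT sc) ((TV.toWinData kitOf wT A WV).zlo 0 j) ((TV.toWinData kitOf wT A WV).zhi 0 j) y →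
      (TV.toCertDataVW kitOf wT sc).σf j y = (TV.toCertDataVW kitOf wT sc).lev j → ∀ v, TailOK (TV.toCertDataVW kitOf wT sc) v → ∀ l,
      |(TV.toCertDataVW kitOf wT sc).ℓ ((TV.toCertDataVW kitOf wT sc).nx j) l ((TV.toCertDataVW kitOf wT sc).land j y v) -
          (TV.toCertDataVW kitOf wT sc).ctr ((TV.toCertDataVW kitOf wT sc).nx j) l| + (TV.toCertDataVW kitOf wT sc).β j l ≤
        (TV.toCertDataVW kitOf wT sc).rad ((TV.toCertDataVW kitOf wT sc).nx j) l - (TV.toCertDataVW kitOf wT sc).s ((TV.toCertDataVW kitOf wT sc).nx j) l := by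
  intro y hy _ v hv l
  rw [rw_zlo0, rw_zhi0] at hy
  rw [cd_nx, cd_ell, cd_land, cd_ctr, cd_beta, cd_rad, cd_sl]
  by_cases hl : l < TV.nF j
  · exact TV.base.readoutStepWin_R9 (TV.roInWin kitOf wT A WV j) hok (mem_faceB _ _) (mem_listB _ _) (mem_listB _ _) (mem_listB _ _)
      (mem_listB _ _) (IntervalD.mem_ofQS2 _ _) (tail_le (kitOf := kitOf) (wT := wT) (sc := sc) hA hv) (memVec_of_inBox_loR hy) hl
  · rw [not_lt] at hl
    obtain ⟨h1, h2, h3, h4, h5⟩ := lengths_le_nF (TV := TV) j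
    rw [List.getD_eq_default _ _ (le_trans h1 hl), TV.base.covR_nil, vget_of_le _ (le_trans h2 hl), vget_of_le _ (le_trans h3 hl),
      vget_of_le _ (le_trans h4 hl), vget_of_le _ (le_trans h5 hl)]
    simp

/-! ### (W1)–(W3): window order and window-end sections -/

/-- **(W1)** of `ReadoutsVW` at stage `j` (window order inside the last sub-step). [folklore] -/
theorem readoutW_W1 {j : ℕ} (hok : (TV.roOutWin kitOf wT A WV j).ok = true) :
    0 ≤ (TV.toWinData kitOf wT A WV).ulo 1 j ∧ (TV.toWinData kitOf wT A WV).ulo 1 j ≤ (TV.toWinData kitOf wT A WV).ulo 0 j ∧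
      (TV.toWinData kitOf wT A WV).ulo 0 j ≤ (TV.toWinData kitOf wT A WV).uhi 0 j ∧
      (TV.toWinData kitOf wT A WV).uhi 0 j ≤ (TV.toWinData kitOf wT A WV).uhi 1 j ∧
      (TV.toWinData kitOf wT A WV).uhi 1 j ≤ (TV.toCertDataVW kitOf wT sc).h j ((TV.toCertDataVW kitOf wT sc).S j - 1) := by
  have h := TV.base.readoutStepWin_win (TV.roInWin kitOf wT A WV j) hok
  rw [rw_ulo0, rw_uhi0, rw_ulo1, rw_uhi1, cd_h]
  exact ⟨h.1, h.2.1, h.2.2.1, h.2.2.2.1, h.2.2.2.2⟩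

/-- **(W2)** of `ReadoutsVW` at stage `j`: window-end section BEFORE, both levels. [folklore] -/
theorem readoutW_W2 (hk : KitOK TV kitOf) {j : ℕ} (hok : (TV.roOutWin kitOf wT A WV j).ok = true) :
    ∀ l : Fin 2, ∀ Ak : Ker, InStepKer (TV.toCertDataVW kitOf wT sc) (TV.toBoxesW kitOf wT) j ((TV.toCertDataVW kitOf wT sc).S j - 1)
        ((TV.toWinData kitOf wT A WV).ulo l j) Ak →
      ∀ y, InBox (TV.toCertDataVW kitOf wT sc) ((TV.toBoxesW kitOf wT).hlo (hullLevel l) j ((TV.toCertDataVW kitOf wT sc).S j - 1))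
          ((TV.toBoxesW kitOf wT).hhi (hullLevel l) j ((TV.toCertDataVW kitOf wT sc).S j - 1)) y →
      ∀ r : Fin 4 → ℤ → ℝ, AbsLeW (TV.toCertDataVW kitOf wT sc) r
          (fun i k => (TV.toBoxesW kitOf wT).J j ((TV.toCertDataVW kitOf wT sc).S j - 1) i k *
            (TV.toWinData kitOf wT A WV).ulo l j ^ ((TV.toCertDataVW kitOf wT sc).pdeg + 1)) →
        (TV.toCertDataVW kitOf wT sc).σf j ((TV.toCertDataVW kitOf wT sc).TP j ((TV.toCertDataVW kitOf wT sc).S j - 1)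
            ((TV.toWinData kitOf wT A WV).ulo l j) + r +
          kapp (TV.toCertDataVW kitOf wT sc) Ak (y - (TV.toCertDataVW kitOf wT sc).x j ((TV.toCertDataVW kitOf wT sc).S j - 1))) <
          (TV.toCertDataVW kitOf wT sc).lev j := by
  have hw := TV.base.readoutStepWin_win (TV.roInWin kitOf wT A WV j) hok
  intro l Ak hA y hy r hr
  rw [cd_sigma, cd_lev]
  rcases l with ⟨_ | _ | l2, hl⟩
  · -- level 0: the endpoint box `Z0a` at `u = u0lo`
    have hm := readoutW_Zl_gen (sc := sc) hk hok (l := 0) rfl (U := ⟨(winAt WV j).u0lo, (winAt WV j).u0lo⟩) (uR := (winAt WV j).u0lo)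
      ⟨le_rfl, le_rfl⟩ hw.2.1 (hw.2.2.1.trans hw.2.2.2.1) le_rfl hA hy hr
    exact (TV.base.readoutStepWin_R5w0 (TV.roInWin kitOf wT A WV j) hok (mem_covB (TV.base.stage j).σf)
      (IntervalD.mem_ofQS2 TV.prec (TV.base.stage j).lev)).1 _ hm
  · -- level 1: the endpoint box `Z1a` at `u = u1lo`
    have hm := readoutW_Zl_gen (sc := sc) hk hok (l := 1) rfl (U := ⟨(winAt WV j).u1lo, (winAt WV j).u1lo⟩) (uR := (winAt WV j).u1lo)
      ⟨le_rfl, le_rfl⟩ le_rfl (hw.2.1.trans (hw.2.2.1.trans hw.2.2.2.1)) le_rfl hA hy hr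
    exact (TV.base.readoutStepWin_R5w1 (TV.roInWin kitOf wT A WV j) hok (mem_covB (TV.base.stage j).σf)
      (IntervalD.mem_ofQS2 TV.prec (TV.base.stage j).lev)).1 _ hm
  · omega

/-- **(W3)** of `ReadoutsVW` at stage `j`: window-end section AFTER, both levels. [folklore] -/
theorem readoutW_W3 (hk : KitOK TV kitOf) {j : ℕ} (hok : (TV.roOutWin kitOf wT A WV j).ok = true) :
    ∀ l : Fin 2, ∀ Ak : Ker, InStepKer (TV.toCertDataVW kitOf wT sc) (TV.toBoxesW kitOf wT) j ((TV.toCertDataVW kitOf wT sc).S j - 1)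
        ((TV.toWinData kitOf wT A WV).uhi l j) Ak →
      ∀ y, InBox (TV.toCertDataVW kitOf wT sc) ((TV.toBoxesW kitOf wT).hlo (hullLevel l) j ((TV.toCertDataVW kitOf wT sc).S j - 1))
          ((TV.toBoxesW kitOf wT).hhi (hullLevel l) j ((TV.toCertDataVW kitOf wT sc).S j - 1)) y →
      ∀ r : Fin 4 → ℤ → ℝ, AbsLeW (TV.toCertDataVW kitOf wT sc) r
          (fun i k => (TV.toBoxesW kitOf wT).J j ((TV.toCertDataVW kitOf wT sc).S j - 1) i k *
            (TV.toWinData kitOf wT A WV).uhi l j ^ ((TV.toCertDataVW kitOf wT sc).pdeg + 1)) →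
        (TV.toCertDataVW kitOf wT sc).lev j <
          (TV.toCertDataVW kitOf wT sc).σf j ((TV.toCertDataVW kitOf wT sc).TP j ((TV.toCertDataVW kitOf wT sc).S j - 1)
            ((TV.toWinData kitOf wT A WV).uhi l j) + r +
          kapp (TV.toCertDataVW kitOf wT sc) Ak (y - (TV.toCertDataVW kitOf wT sc).x j ((TV.toCertDataVW kitOf wT sc).S j - 1))) := by
  have hw := TV.base.readoutStepWin_win (TV.roInWin kitOf wT A WV j) hok
  intro l Ak hA y hy r hr
  rw [cd_sigma, cd_lev]
  rcases l with ⟨_ | _ | l2, hl⟩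
  · -- level 0: the endpoint box `Z0b` at `u = u0hi`
    have hm := readoutW_Zl_gen (sc := sc) hk hok (l := 0) rfl (U := ⟨(winAt WV j).u0hi, (winAt WV j).u0hi⟩) (uR := (winAt WV j).u0hi)
      ⟨le_rfl, le_rfl⟩ (hw.2.1.trans hw.2.2.1) hw.2.2.2.1 le_rfl hA hy hr
    exact (TV.base.readoutStepWin_R5w0 (TV.roInWin kitOf wT A WV j) hok (mem_covB (TV.base.stage j).σf)
      (IntervalD.mem_ofQS2 TV.prec (TV.base.stage j).lev)).2 _ hm
  · -- level 1: the endpoint box `Z1b` at `u = u1hi`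
    have hm := readoutW_Zl_gen (sc := sc) hk hok (l := 1) rfl (U := ⟨(winAt WV j).u1hi, (winAt WV j).u1hi⟩) (uR := (winAt WV j).u1hi)
      ⟨le_rfl, le_rfl⟩ (hw.2.1.trans (hw.2.2.1.trans hw.2.2.2.1)) le_rfl le_rfl hA hy hr
    exact (TV.base.readoutStepWin_R5w1 (TV.roInWin kitOf wT A WV j) hok (mem_covB (TV.base.stage j).σf)
      (IntervalD.mem_ofQS2 TV.prec (TV.base.stage j).lev)).2 _ hm
  · omega

end CertTablesV

end Summit.NavierStokesRegularity.NavierStokesRegularity.Theorems.TaylorModelCert
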